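import Mathlib.AlgebraicGeometry.EllipticCurve.Affine.Point
import Mathlib.RingTheory.DedekindDomain.AdicValuation
import Mathlib.RingTheory.Valuation.ExtendToLocalization
import Mathlib.RingTheory.Valuation.IsTrivialOn
import Mathlib.FieldTheory.IsAlgClosed.Basic
import Mathlib.LinearAlgebra.FreeModule.Norm
import Mathlib.RingTheory.Norm.Basic
import Literature.NumberTheory.EllipticCurves.CoordinateRingRegular
import Literature.NumberTheory.EllipticCurves.IsogenyDegreeProofs
import Literature.NumberTheory.DiophantineGeometry.WeierstrassPlaceAtInfinity
import Literature.NumberTheory.DiophantineGeometry.FunctionFieldGenusWeierstrassProofs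
import HarnessLib

/-!
# Places of the function field of an elliptic curve and `deg div(f) = 0` (Silverman, *AEC*, II.§1–3)

Trunk T-ELLARITH (group G16); notion `cm_endomorphisms_isogeny`. Serves the named fact
`Literature.AlgebraicGeometry.Motives.linearIndependent_tateModule_map` of `Literature.AlgebraicGeometry.Motives.FaltingsEC`
(Silverman, *AEC*, Thm. III.7.4): after `FaltingsECProofs`
(`Literature.AlgebraicGeometry.Motives.linearIndependent_tateModule_map_of_degree`), `IsogenyDegreeProofs` (II.2.4(a)) and
`FunctionFieldTranslation` (`#ker φ ∣ deg φ`), what III.7.4 still needs is a **quadratic** degree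
function on `Hom_K(E, E')` (the parallelogram law of *AEC* Cor. III.6.3, whose printed proof rests
on the dual isogeny). The route taken in this programme proves the parallelogram law instead for
the *divisor-theoretic* degree of `L`-points of `E'` over the function field `L = K̄(E)` (the
number of poles of `x'(A)` counted with multiplicity), from the theory of zeros and poles of
rational functions on `E`. This file is the first layer of that theory, for a Weierstrass curve
`V` with non-zero discriminant over an algebraically closed field `k` (applied later to
`V = E ×_K K̄`): **the places of `k(V)` are the points of `V(k)` together with `O`, each residue
field is `k`, and a non-zero rational function has as many zeros as poles** —
`Literature.WeierstrassFunctionField.finsum_ord : ∑ᶠ P, ord_P(u) = 0` (*AEC* Prop. II.3.1(b) with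
II.1.2; Silverman cites Hartshorne II.6 for it), building on the tree's place at infinity
(`Literature.NumberTheory.DiophantineGeometry.WeierstrassPlaceAtInfinity`) and residue lemmas
(see "Relation to the tree's function-field files" below).

## Contents (all definitions are real)

* `pointIdeal V a b = (x - a, y - b) ⊆ k[V]` (Mathlib's `XYIdeal`), `pointEval h : k[V] →+* k`
  (evaluation at a point `(a, b)` of `V`, Mathlib's `AdjoinRoot.evalEval`); `ker_pointEval`,
  `pointIdeal_isMaximal`, `mk_mem_pointIdeal_iff` (`g ∈ (x - a, y - b) ↔ g(a, b) = 0`),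
  `pointPrime h` (the height-one prime of the Dedekind domain `k[V]`, using the tree's
  `CoordinateRingRegular`), and **`exists_eq_pointIdeal`: every maximal ideal of `k[V]` is the
  ideal of a point** (Nullstellensatz for `V`, `k` algebraically closed).
* `normDeg V w = deg N_{k[V]/k[x]}(w)` and its relation to the tree's valuation at infinity
  `Literature.NumberTheory.DiophantineGeometry.WeierstrassPlaceAtInfinity.infValuationF` (`infValuationF_algebraMap_of_ne_zero`).
* **`placeValuation V : V.Point → Valuation k(V) ℤᵐ⁰`** (adic valuation of `pointPrime` at an
  affine point, the tree's `infValuationF` at `O`; Mathlib's convention `v(u) = exp (-ord u)`) and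
  **`ord V P u ∈ ℤ`**; trivial on constants (`placeValuation_algebraMap`), non-trivial
  (`exists_placeValuation_ne_one`), `ord_mul`, `ord_div`, `ord_zero_X` (`ord_O x = -2`).
* **Residue fields are `k`** (for every field `k`): `exists_placeValuation_sub_lt_one` (from the
  tree's `exists_infValuationF_sub_algebraMap_lt_one` at `O` and
  `Literature.NumberTheory.DiophantineGeometry.WeierstrassGenus.exists_valuation_sub_algebraMap_lt_one` at finite places), the residue
  **`placeRes V P u ∈ k`** with its ring-homomorphism properties on `v_P ≤ 1` (`placeRes_add`,
  `_mul`, `_neg`, `_sub`, `_inv`, `_algebraMap`) and its agreement with evaluation at affine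
  points (`placeRes_some_algebraMap`).
* **Degree of principal divisors** (`k` algebraically closed): `ord_some_algebraMap_eq_count`
  (`ord_{(a,b)}(w)` is the multiplicity of `(x - a, y - b)` in `(w)`),
  `finrank_quotient_pointIdeal_pow` (`dim_k k[V]/𝔪ⁿ = n`), `finrank_quotient_span_eq_sum_count`
  (Chinese remainder), `sum_count_eq_normDeg` (`Σ_𝔪 e_𝔪 = dim_k k[V]/(w) = deg N(w)`, Mathlib's
  `finrank_quotient_span_eq_natDegree_norm`), `finite_support_ord` (finitely many zeros and
  poles), and **`finsum_ord_algebraMap`, `finsum_ord`: `∑ᶠ P, ord V P u = 0` for `u ≠ 0`**.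

## Relation to the tree's function-field files

The tree already has the abstract place theory of `K(W)/K` for Weierstrass curves over any field:
`Literature.NumberTheory.DiophantineGeometry.WeierstrassPlaceAtInfinity` (the place at infinity
`infValuation`, `infValuationF`, `infPlace`, its residue field,
`exists_infValuationF_sub_algebraMap_lt_one`),
`…WeierstrassFunctionFieldPlaces` (`isAlgFunctionField`, the classification
`placeEquiv : Option (HeightOneSpectrum K[W]) ≃ PlaceOver K K(W)`),
`…FunctionFieldGenusWeierstrassProofs` (residues at finite places), and the divisor theory of
`…FunctionFieldDivisors*` (`PlaceOver.ord`, `principalDivisor`, and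
`Literature.NumberTheory.DiophantineGeometry.AlgFunctionField.degree_principalDivisor_eq_zero`, Stichtenoth Thm. 1.4.11). This file
reuses the place at infinity and the residue lemmas, and adds the **point-indexed** layer the
later files compute with (`V.Point`-indexed adic valuations, `ord`, `placeRes`, residues read off
by `pointEval`, `ord = multiplicity in the factorisation`). `finsum_ord` is the specialisation of
`degree_principalDivisor_eq_zero` to `k = k̄` (all places of degree one and `V.Point ≃` places);
it is proved here directly (Chinese remainder and `dim k[V]/𝔪ⁿ = n`, about 150 lines) rather than
transported, because the transport needs the identification of `PlaceOver.ord` (the valuation of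
the DVR `O_v`) with the point-indexed adic valuations and the degree-one computation for all
places, which is not shorter; downstream only the point-indexed `ord` is used.

## Faithfulness

For `k` algebraically closed and `Δ(V) ≠ 0`, the smooth projective model of `V` has points
`V(k) ∪ {O}`; its local rings are the DVRs `k[V]_𝔪` (tree: `k[V]` is Dedekind) and the valuation
ring of `v_O` (tree's `infPlace`; `x/y` is a uniformiser: `ord_O x = -2`, `ord_O y = -3`, *AEC*
II.§1 and III.§1). So `ord V P` is Silverman's `ord_P` (II.§1) and `finsum_ord` is
`deg (div f) = 0` (II.3.1(b)): the affine zeros of `w ∈ k[V]` number `dim_k k[V]/(w)`, which is the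
degree of the norm of `w`, which is the order of the pole of `w` at `O`.

## Mathlib

Used: `IsDedekindDomain.HeightOneSpectrum.valuation` and its API, `Algebra.norm`,
`CoordinateRing.basis`, `degree_norm_smul_basis`, `finrank_quotient_span_eq_natDegree_norm`,
`IsDedekindDomain.quotientEquivPiFactors`, `Ideal.irreducible_pow_sup`,
`Ideal.count_normalizedFactors_eq`, `WithZero.exp/log`. Mathlib has no places or valuations
attached to points of a Weierstrass curve (the tree's files above supply the abstract theory).

## References

* [SilvermanAEC2009] J. H. Silverman, *The Arithmetic of Elliptic Curves*, 2nd ed., GTM 106,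
  Springer 2009: II.§1 (`K̄[C]_P`, `ord_P`, Prop. II.1.1, II.1.2), II.§3 (divisors,
  Prop. II.3.1: `deg div f = 0`), III.§1 and Prop. III.3.1 (`ord_O x = -2`, `ord_O y = -3`),
  III.§3.
* H. Stichtenoth, *Algebraic Function Fields and Codes*, 2nd ed., GTM 254, Springer 2009,
  Thm. 1.4.11 (principal divisors have degree zero), the tree's route.
* R. Hartshorne, *Algebraic Geometry*, GTM 52, II.6 (Cor. II.6.10), the input Silverman cites.

## Design choices

* Generic over a field `k` and `V : WeierstrassCurve.Affine k` in `namespace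
  Literature.WeierstrassFunctionField` (as the generic parts of `IsogenyDegreeProofs` and
  `FunctionFieldTranslation`); `[V.IsElliptic]` (for the Dedekind property) and `[IsAlgClosed k]`
  (for the Nullstellensatz and the degree count) only where needed. Universe-polymorphic.
* Valuations are Mathlib `Valuation _ ℤᵐ⁰` (multiplicative); `ord` is the additive `ℤ`-valued
  shadow used in sums (`∑ᶠ`), with junk value `0` at `u = 0`.
-/

noncomputable section

open scoped Classical WithZero
open scoped Polynomial.Bivariate
open Polynomial IsDedekindDomain

universe u

namespace Literature.NumberTheory.EllipticCurves.WeierstrassFunctionField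

variable {k : Type u} [Field k] (V : WeierstrassCurve.Affine k)

/-! ## The maximal ideal of an affine point -/

/-- The ideal `(x - a, y - b) ⊆ k[V]` of a point `(a, b)` (Mathlib's `XYIdeal a (C b)`).
[folklore] -/
abbrev pointIdeal (a b : k) : Ideal V.CoordinateRing :=
  WeierstrassCurve.Affine.CoordinateRing.XYIdeal V a (C b)

variable {V}

/-- Evaluation at a point `(a, b)` of the curve, `k[V] → k` (Mathlib's `AdjoinRoot.evalEval`).
[folklore] -/
def pointEval {a b : k} (h : V.Equation a b) : V.CoordinateRing →+* k :=
  AdjoinRoot.evalEval h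

/-- Evaluation of the class of a polynomial. [folklore] -/
theorem pointEval_mk {a b : k} (h : V.Equation a b) (p : k[X][Y]) :
    pointEval h (WeierstrassCurve.Affine.CoordinateRing.mk V p) = p.evalEval a b :=
  AdjoinRoot.evalEval_mk h p

/-- Evaluation of a constant. [folklore] -/
theorem pointEval_algebraMap {a b : k} (h : V.Equation a b) (c : k) :
    pointEval h (algebraMap k V.CoordinateRing c) = c := by
  rw [show algebraMap k V.CoordinateRing c = WeierstrassCurve.Affine.CoordinateRing.mk V (C (C c))
    from rfl, pointEval_mk, evalEval_CC]

/-- Evaluation at a point is onto `k`. [folklore] -/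
theorem pointEval_surjective {a b : k} (h : V.Equation a b) : Function.Surjective (pointEval h) :=
  fun c ↦ ⟨_, pointEval_algebraMap h c⟩

/-- The ideal of a point of the curve is maximal (`k[V]/(x - a, y - b) ≅ k`). [folklore] -/
theorem pointIdeal_isMaximal {a b : k} (h : V.Equation a b) : (pointIdeal V a b).IsMaximal := by
  have e := WeierstrassCurve.Affine.CoordinateRing.quotientXYIdealEquiv (W' := V) (x := a)
    (y := C b) h
  exact Ideal.Quotient.maximal_of_isField _ (e.toMulEquiv.isField (Field.toIsField k))

/-- **The ideal of a point is the kernel of evaluation at the point.** [folklore] -/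
theorem ker_pointEval {a b : k} (h : V.Equation a b) :
    RingHom.ker (pointEval h) = pointIdeal V a b := by
  haveI := pointIdeal_isMaximal h
  refine (Ideal.IsMaximal.eq_of_le inferInstance (RingHom.ker_ne_top _) ?_).symm
  rw [pointIdeal, WeierstrassCurve.Affine.CoordinateRing.XYIdeal, Ideal.span_le]
  rintro r (rfl | hr)
  · rw [SetLike.mem_coe, RingHom.mem_ker, WeierstrassCurve.Affine.CoordinateRing.XClass,
      pointEval_mk, evalEval_C, eval_sub, eval_X, eval_C, sub_self]
  · rw [Set.mem_singleton_iff] at hr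
    subst hr
    rw [SetLike.mem_coe, RingHom.mem_ker, WeierstrassCurve.Affine.CoordinateRing.YClass,
      pointEval_mk, evalEval_sub, evalEval_X, evalEval_C, eval_C, sub_self]

/-- `g(x, y) ∈ (x - a, y - b) ↔ g(a, b) = 0`. [folklore] -/
theorem mk_mem_pointIdeal_iff {a b : k} (h : V.Equation a b) (p : k[X][Y]) :
    WeierstrassCurve.Affine.CoordinateRing.mk V p ∈ pointIdeal V a b ↔ p.evalEval a b = 0 := by
  rw [← ker_pointEval h, RingHom.mem_ker, pointEval_mk]

/-- `r ∈ (x - a, y - b) ↔ r(a, b) = 0`. [folklore] -/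
theorem mem_pointIdeal_iff {a b : k} (h : V.Equation a b) (r : V.CoordinateRing) :
    r ∈ pointIdeal V a b ↔ pointEval h r = 0 := by
  rw [← ker_pointEval h, RingHom.mem_ker]

/-- `aevalAeval u v p` is `evalEval u v` of `p` with mapped coefficients (the tree's
`aevalAeval_eq_evalEval_map` of `FunctionFieldTranslation`, restated to keep this file's imports
independent of that sibling). [folklore] -/
theorem aevalAeval_eq_evalEval_map' {A : Type*} [CommRing A] [Algebra k A] (u v : A)
    (p : k[X][Y]) : aevalAeval u v p = (p.map (mapRingHom (algebraMap k A))).evalEval u v := by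
  rw [← eval₂_eval₂RingHom_apply]
  change (aevalAeval u v : k[X][Y] →ₐ[k] A).toRingHom p = (eval₂RingHom (eval₂RingHom _ u) v) p
  congr 1
  refine Polynomial.ringHom_ext' ?_ ?_
  · refine Polynomial.ringHom_ext' ?_ ?_
    · ext c
      simp
    · simp
  · simp

/-- In `k[V]`, the class of `p` is `p` evaluated at the classes of `X` and `Y`. [folklore] -/
theorem mk_eq_aevalAeval (p : k[X][Y]) : WeierstrassCurve.Affine.CoordinateRing.mk V p =
    aevalAeval (algebraMap k[X] V.CoordinateRing X)
      (WeierstrassCurve.Affine.CoordinateRing.mk V Y) p := by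
  have : (WeierstrassCurve.Affine.CoordinateRing.mk V : k[X][Y] →+* _) =
      (aevalAeval (algebraMap k[X] V.CoordinateRing X)
        (WeierstrassCurve.Affine.CoordinateRing.mk V Y) : k[X][Y] →ₐ[k] _).toRingHom := by
    refine Polynomial.ringHom_ext' (Polynomial.ringHom_ext' (RingHom.ext fun c ↦ ?_) ?_) ?_
    · simp only [RingHom.comp_apply, AlgHom.toRingHom_eq_coe, RingHom.coe_coe, aevalAeval_C,
        aeval_C]
      rfl
    · simp only [RingHom.comp_apply, AlgHom.toRingHom_eq_coe, RingHom.coe_coe, aevalAeval_X]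
      rfl
    · simp only [AlgHom.toRingHom_eq_coe, RingHom.coe_coe, aevalAeval_Y]
  exact RingHom.congr_fun this p

/-- Algebra maps commute with `aevalAeval`. [folklore] -/
theorem map_aevalAeval {A B : Type*} [CommRing A] [CommRing B] [Algebra k A] [Algebra k B]
    (σ : A →ₐ[k] B) (u v : A) (p : k[X][Y]) :
    σ (aevalAeval u v p) = aevalAeval (σ u) (σ v) p := by
  change (σ.comp (aevalAeval u v)) p = _
  congr 1
  refine Polynomial.algHom_ext' (Polynomial.algHom_ext ?_) ?_ <;> simp

/-- `W(X, Y)` with `X ↦ a` substituted in the coefficients, evaluated at `v`, is `W(a, v)`.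
[folklore] -/
theorem aeval_map_evalRingHom {A : Type*} [CommRing A] [Algebra k A] (a : k) (v : A)
    (p : k[X][Y]) : aeval v (p.map (evalRingHom a)) = aevalAeval (algebraMap k A a) v p := by
  rw [aevalAeval_eq_evalEval_map', ← map_evalRingHom_eval, Polynomial.map_map,
    show (evalRingHom (algebraMap k A a)).comp (mapRingHom (algebraMap k A)) =
      (algebraMap k A).comp (evalRingHom a) from Polynomial.ringHom_ext (fun c ↦ by simp) (by simp),
    ← Polynomial.map_map, aeval_def, eval₂_eq_eval_map]

/-- Distinct points have distinct ideals. [folklore] -/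
theorem pointIdeal_injective {a b a' b' : k} (h : V.Equation a b)
    (e : pointIdeal V a b = pointIdeal V a' b') : a = a' ∧ b = b' := by
  have hx : WeierstrassCurve.Affine.CoordinateRing.mk V (C (X - C a')) ∈ pointIdeal V a b := by
    rw [e]; exact Ideal.subset_span (Or.inl rfl)
  have hy : WeierstrassCurve.Affine.CoordinateRing.mk V (Y - C (C b')) ∈ pointIdeal V a b := by
    rw [e]; exact Ideal.subset_span (Or.inr rfl)
  rw [mk_mem_pointIdeal_iff h] at hx hy
  simp only [evalEval_C, eval_sub, eval_X, eval_C, evalEval_sub, evalEval_X] at hx hy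
  exact ⟨sub_eq_zero.mp hx, sub_eq_zero.mp hy⟩

section Elliptic

variable [V.IsElliptic]

/-- The ideal of a point is a nonzero prime: a height-one prime of the Dedekind domain `k[V]`.
[folklore] -/
def pointPrime {a b : k} (h : V.Equation a b) : HeightOneSpectrum V.CoordinateRing :=
  ⟨pointIdeal V a b, (pointIdeal_isMaximal h).isPrime,
    @Literature.NumberTheory.EllipticCurves.WeierstrassCoordinateRing.ne_bot_of_isMaximal _ _ V _ (pointIdeal_isMaximal h)⟩

omit [V.IsElliptic] in
/-- The underlying ideal of `pointPrime`. [folklore] -/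
@[simp] theorem pointPrime_asIdeal {a b : k} [V.IsElliptic] (h : V.Equation a b) :
    (pointPrime h).asIdeal = pointIdeal V a b := rfl

end Elliptic

/-- **Maximal ideals of `k[V]` are ideals of points** (`k` algebraically closed): for a maximal
`𝔪`, the classes of `x` and `y` in the field `k[V]/𝔪` are algebraic over `k` (`x` satisfies the
generator of `𝔪 ∩ k[X]`, and `y` the Weierstrass equation), hence constants `a, b`, and then
`(x - a, y - b) ⊆ 𝔪` with `(a, b)` on the curve. Hilbert's Nullstellensatz for the curve `V`.
[folklore] -/
theorem exists_eq_pointIdeal [IsAlgClosed k] (m : Ideal V.CoordinateRing) [hm : m.IsMaximal] :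
    ∃ a b : k, ∃ _ : V.Equation a b, m = pointIdeal V a b := by
  let Q := V.CoordinateRing ⧸ m
  letI : Field Q := Ideal.Quotient.field m
  -- the class of `x` is algebraic: it is a root of the generator of `m ∩ k[X]`
  set xq : Q := Ideal.Quotient.mk m (algebraMap k[X] V.CoordinateRing X) with hxq
  set yq : Q := Ideal.Quotient.mk m (WeierstrassCurve.Affine.CoordinateRing.mk V Y) with hyq
  have halgx : IsAlgebraic k xq := by
    refine ⟨Literature.NumberTheory.EllipticCurves.WeierstrassCoordinateRing.gen m, Literature.NumberTheory.EllipticCurves.WeierstrassCoordinateRing.gen_ne_zero m, ?_⟩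
    have h1 : aeval xq (Literature.NumberTheory.EllipticCurves.WeierstrassCoordinateRing.gen m) = Ideal.Quotient.mkₐ k m
        (algebraMap k[X] V.CoordinateRing (Literature.NumberTheory.EllipticCurves.WeierstrassCoordinateRing.gen m)) := by
      rw [hxq, ← Ideal.Quotient.mkₐ_eq_mk k, show algebraMap k[X] V.CoordinateRing X =
        IsScalarTower.toAlgHom k k[X] V.CoordinateRing X from rfl, aeval_algHom_apply,
        aeval_algHom_apply, aeval_X_left_apply]
      rfl
    rw [h1, Ideal.Quotient.mkₐ_eq_mk, Ideal.Quotient.eq_zero_iff_mem]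
    exact Literature.NumberTheory.EllipticCurves.WeierstrassCoordinateRing.cR_gen_mem m
  obtain ⟨a, ha⟩ : xq ∈ (algebraMap k Q).range :=
    minpoly.mem_range_of_degree_eq_one k xq
      (IsAlgClosed.degree_eq_one_of_irreducible k (minpoly.irreducible halgx.isIntegral))
  -- the Weierstrass polynomial vanishes at `(xq, yq)`
  have hW : aevalAeval xq yq V.polynomial = 0 := by
    rw [hxq, hyq, ← Ideal.Quotient.mkₐ_eq_mk k, ← map_aevalAeval, ← mk_eq_aevalAeval,
      Ideal.Quotient.mkₐ_eq_mk]
    change Ideal.Quotient.mk m (AdjoinRoot.mk V.polynomial V.polynomial) = 0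
    rw [AdjoinRoot.mk_self, map_zero]
  -- the class of `y` is algebraic: it is a root of `W(a, Y)`
  set q : k[X] := V.polynomial.map (evalRingHom a) with hq
  have hqm : q.Monic := (WeierstrassCurve.Affine.monic_polynomial (W := V)).map _
  have halgy : IsAlgebraic k yq := by
    refine ⟨q, hqm.ne_zero, ?_⟩
    rw [hq, aeval_map_evalRingHom, ha, hW]
  obtain ⟨b, hb⟩ : yq ∈ (algebraMap k Q).range :=
    minpoly.mem_range_of_degree_eq_one k yq
      (IsAlgClosed.degree_eq_one_of_irreducible k (minpoly.irreducible halgy.isIntegral))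
  -- `(a, b)` lies on the curve
  have hab : V.Equation a b := by
    have : algebraMap k Q (V.polynomial.evalEval a b) = 0 := by
      rw [← map_mapRingHom_evalEval, ← aevalAeval_eq_evalEval_map', ha, hb, hW]
    exact (map_eq_zero _).mp this
  refine ⟨a, b, hab, ?_⟩
  -- `(x - a, y - b) ⊆ m`, and the former is maximal
  haveI := pointIdeal_isMaximal hab
  refine (Ideal.IsMaximal.eq_of_le inferInstance hm.ne_top ?_).symm
  rw [pointIdeal, WeierstrassCurve.Affine.CoordinateRing.XYIdeal, Ideal.span_le]
  rintro r (rfl | hr)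
  · rw [SetLike.mem_coe, ← Ideal.Quotient.eq_zero_iff_mem,
      WeierstrassCurve.Affine.CoordinateRing.XClass, map_sub, map_sub]
    change xq - Ideal.Quotient.mk m (algebraMap k V.CoordinateRing a) = 0
    rw [Ideal.Quotient.mk_algebraMap, ha, sub_self]
  · rw [Set.mem_singleton_iff] at hr
    subst hr
    rw [SetLike.mem_coe, ← Ideal.Quotient.eq_zero_iff_mem,
      WeierstrassCurve.Affine.CoordinateRing.YClass, map_sub, map_sub]
    change yq - Ideal.Quotient.mk m (algebraMap k V.CoordinateRing b) = 0
    rw [Ideal.Quotient.mk_algebraMap, hb, sub_self]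


/-! ## The place at infinity (tree: `Literature.WeierstrassPlaceAtInfinity`)

The valuation `v_O` of `k(V)` at the point at infinity `O` is the tree's
`Literature.WeierstrassPlaceAtInfinity.infValuationF V` (norm to `k[X]`: for `w = p(x) + q(x) y ∈ k[V]`,
`-ord_O(w) = deg_x N(w) = max (2 deg p, 2 deg q + 3)`; `ord_O x = -2`, `ord_O y = -3`, its
`infValuationF_x`, `infValuationF_y`). We only add the name `normDeg` for the degree of the norm
and two unfolding lemmas. -/

section InfinitePlace

variable (V)

/-- `deg N_{k[V]/k[X]}(w)`, the order of the pole at infinity of `w ∈ k[V]` (for `w ≠ 0`).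
Silverman, *AEC*, III.§1 (`ord_O x = -2`, `ord_O y = -3`). [folklore] -/
def normDeg (w : V.CoordinateRing) : ℕ :=
  (Algebra.norm k[X] w).natDegree

variable {V}

/-- `v_O(w) = exp (deg N w)` for `w ∈ k[V] ∖ {0}` (unfolding the tree's `infValuationF`).
[folklore] -/
theorem infValuationF_algebraMap_of_ne_zero {w : V.CoordinateRing} (hw : w ≠ 0) :
    Literature.NumberTheory.DiophantineGeometry.WeierstrassPlaceAtInfinity.infValuationF V
      (algebraMap V.CoordinateRing V.FunctionField w) = WithZero.exp (normDeg V w : ℤ) := by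
  rw [Literature.NumberTheory.DiophantineGeometry.WeierstrassPlaceAtInfinity.infValuationF_algebraMap,
    Literature.NumberTheory.DiophantineGeometry.WeierstrassPlaceAtInfinity.infValuation_apply V hw]
  rfl

/-- Non-zero constants have `v_O = 1` (the tree's `infValuation_C`). [folklore] -/
theorem infValuationF_algebraMap_base {c : k} (hc : c ≠ 0) :
    Literature.NumberTheory.DiophantineGeometry.WeierstrassPlaceAtInfinity.infValuationF V (algebraMap k V.FunctionField c) = 1 := by
  rw [IsScalarTower.algebraMap_apply k k[X] V.FunctionField,
    IsScalarTower.algebraMap_apply k[X] V.CoordinateRing V.FunctionField,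
    Literature.NumberTheory.DiophantineGeometry.WeierstrassPlaceAtInfinity.infValuationF_algebraMap, Polynomial.algebraMap_eq]
  exact Literature.NumberTheory.DiophantineGeometry.WeierstrassPlaceAtInfinity.infValuation_C V hc

/-- `deg N(p + q y) = max (2 deg p, 2 deg q + 3)` for `p + q y ≠ 0` (Mathlib's
`degree_norm_smul_basis`). [folklore] -/
theorem normDeg_smul_basis {p q : k[X]} (h : p • (1 : V.CoordinateRing) +
      q • WeierstrassCurve.Affine.CoordinateRing.mk V Y ≠ 0) :
    (normDeg V (p • (1 : V.CoordinateRing) + q • WeierstrassCurve.Affine.CoordinateRing.mk V Y) :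
      WithBot ℕ) = max (2 • p.degree) (2 • q.degree + 3) := by
  rw [normDeg, ← WeierstrassCurve.Affine.CoordinateRing.degree_norm_smul_basis,
    degree_eq_natDegree (Literature.NumberTheory.DiophantineGeometry.WeierstrassPlaceAtInfinity.norm_ne_zero V h)]

end InfinitePlace

/-! ## The places of `k(V)`: one valuation for each point of `V(k)` -/

section Places

variable (V) [V.IsElliptic]

/-- **The valuation of `k(V)` at a point of `V`**: for an affine point `(a, b)` the adic
valuation of the Dedekind domain `k[V]` at the maximal ideal `(x - a, y - b)`, and for the point at
infinity `O` the tree's `infValuationF` (Mathlib's multiplicative convention, values in `ℤᵐ⁰`: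
`v_P(u) < 1` iff `u(P) = 0`, `v_P(u) > 1` iff `u` has a pole at `P`). Silverman, *AEC*, II.§1
(`ord_P`, Prop. II.1.1). [folklore] -/
def placeValuation : V.Point → Valuation V.FunctionField ℤᵐ⁰
  | .zero => Literature.NumberTheory.DiophantineGeometry.WeierstrassPlaceAtInfinity.infValuationF V
  | .some _ _ h => (pointPrime h.left).valuation V.FunctionField

/-- **`ord_P(u) ∈ ℤ`**, the order of vanishing of `u ∈ k(V)` at the point `P`
(`v_P(u) = exp (-ord_P u)`; junk value `0` at `u = 0`). Silverman, *AEC*, II.§1. [folklore] -/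
def ord (P : V.Point) (u : V.FunctionField) : ℤ :=
  -WithZero.log (placeValuation V P u)

variable {V}

/-- The valuation at `O` is the tree's `infValuationF`. [folklore] -/
theorem placeValuation_zero :
    placeValuation V 0 = Literature.NumberTheory.DiophantineGeometry.WeierstrassPlaceAtInfinity.infValuationF V := rfl

/-- The valuation at `O` is the tree's `infValuationF` (constructor form). [folklore] -/
theorem placeValuation_zero' :
    placeValuation V .zero = Literature.NumberTheory.DiophantineGeometry.WeierstrassPlaceAtInfinity.infValuationF V := rfl

/-- The valuation at an affine point is the adic valuation of its ideal. [folklore] -/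
theorem placeValuation_some {a b : k} (h : V.Nonsingular a b) :
    placeValuation V (.some a b h) = (pointPrime h.left).valuation V.FunctionField := rfl

/-- `v_P(u) ≠ 0` for `u ≠ 0`. [folklore] -/
theorem placeValuation_ne_zero (P : V.Point) {u : V.FunctionField} (hu : u ≠ 0) :
    placeValuation V P u ≠ 0 :=
  (Valuation.ne_zero_iff _).mpr hu

/-- `v_P(u) = exp (-ord_P u)` for `u ≠ 0`. [folklore] -/
theorem placeValuation_eq_exp_neg_ord (P : V.Point) {u : V.FunctionField} (hu : u ≠ 0) :
    placeValuation V P u = WithZero.exp (-ord V P u) := by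
  rw [ord, neg_neg, WithZero.exp_log (placeValuation_ne_zero P hu)]

/-- `ord_P (u w) = ord_P u + ord_P w`. Silverman, *AEC*, II.§1. [folklore] -/
theorem ord_mul (P : V.Point) {u w : V.FunctionField} (hu : u ≠ 0) (hw : w ≠ 0) :
    ord V P (u * w) = ord V P u + ord V P w := by
  rw [ord, ord, ord, map_mul, WithZero.log_mul (placeValuation_ne_zero P hu)
    (placeValuation_ne_zero P hw), neg_add]

/-- `ord_P (u⁻¹) = -ord_P u`. [folklore] -/
theorem ord_inv (P : V.Point) (u : V.FunctionField) : ord V P u⁻¹ = -ord V P u := by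
  rw [ord, ord, map_inv₀, WithZero.log_inv, neg_neg]

/-- `ord_P (u / w) = ord_P u - ord_P w`. [folklore] -/
theorem ord_div (P : V.Point) {u w : V.FunctionField} (hu : u ≠ 0) (hw : w ≠ 0) :
    ord V P (u / w) = ord V P u - ord V P w := by
  rw [div_eq_mul_inv, ord_mul P hu (inv_ne_zero hw), ord_inv, sub_eq_add_neg]

/-- `ord_P` of a nonzero constant is `0`: the valuations are trivial on `k`. [folklore] -/
theorem placeValuation_algebraMap (P : V.Point) {c : k} (hc : c ≠ 0) :
    placeValuation V P (algebraMap k V.FunctionField c) = 1 := by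
  cases P with
  | zero => exact infValuationF_algebraMap_base hc
  | some a b h =>
    rw [placeValuation_some, IsScalarTower.algebraMap_apply k V.CoordinateRing V.FunctionField,
      HeightOneSpectrum.valuation_eq_one_iff_notMem, pointPrime_asIdeal, mem_pointIdeal_iff h.left,
      pointEval_algebraMap]
    exact hc

/-- The valuations are trivial on the constants. [folklore] -/
instance (P : V.Point) : (placeValuation V P).IsTrivialOn k :=
  ⟨fun _ hc ↦ placeValuation_algebraMap P hc⟩

/-- `ord_P c = 0` for a constant `c`. [folklore] -/
theorem ord_algebraMap (P : V.Point) (c : k) : ord V P (algebraMap k V.FunctionField c) = 0 := by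
  by_cases hc : c = 0
  · simp [ord, hc]
  · rw [ord, placeValuation_algebraMap P hc, WithZero.log_one, neg_zero]

/-- `ord_O x = -2` (the tree's `infValuationF_x`).
[cite: SilvermanAEC2009, Prop. III.3.1 (proof of (a))] -/
theorem ord_zero_X : ord V 0 (algebraMap k[X] V.FunctionField X) = -2 := by
  rw [ord, placeValuation_zero, Literature.NumberTheory.DiophantineGeometry.WeierstrassPlaceAtInfinity.infValuationF_x, WithZero.log_exp]

/-- Each valuation `v_P` is non-trivial: some element has valuation `≠ 1`. [folklore] -/
theorem exists_placeValuation_ne_one (P : V.Point) :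
    ∃ u : V.FunctionField, u ≠ 0 ∧ placeValuation V P u ≠ 1 := by
  cases P with
  | zero =>
    refine ⟨algebraMap k[X] V.FunctionField X, ?_, ?_⟩
    · intro h0
      rw [IsScalarTower.algebraMap_apply k[X] V.CoordinateRing V.FunctionField,
        map_eq_zero_iff _ (FaithfulSMul.algebraMap_injective _ _),
        map_eq_zero_iff _ (Literature.NumberTheory.EllipticCurves.WeierstrassCoordinateRing.algebraMap_injective V)] at h0
      exact X_ne_zero h0
    · rw [placeValuation_zero', Literature.NumberTheory.DiophantineGeometry.WeierstrassPlaceAtInfinity.infValuationF_x, ← WithZero.exp_zero,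
        Ne, WithZero.exp_inj]
      decide
  | some a b h =>
    obtain ⟨π, hπ⟩ := (pointPrime h.left).valuation_exists_uniformizer V.FunctionField
    refine ⟨π, fun h0 ↦ ?_, ?_⟩
    · rw [h0, map_zero] at hπ
      exact WithZero.exp_ne_zero hπ.symm
    · rw [placeValuation_some, hπ, ← WithZero.exp_zero, Ne, WithZero.exp_inj]
      decide

/-! ### Residues: the residue field of every place is `k` -/

/-- **The residue field at every point is `k`**: if `v_P(u) ≤ 1` then `v_P(u - c) < 1` for some
constant `c` (the value `u(P)`). At `O` this is the tree's
`Literature.NumberTheory.DiophantineGeometry.WeierstrassPlaceAtInfinity.exists_infValuationF_sub_algebraMap_lt_one`; at an affine point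
`(a, b)` the tree's `Literature.NumberTheory.DiophantineGeometry.WeierstrassGenus.exists_valuation_sub_algebraMap_lt_one` gives
`r ∈ k[V]` with `v(u - r) < 1`, and `v(r - r(a, b)) < 1`. Silverman, *AEC*, II.§1 (`f(P)` for
`f` regular at `P`; Prop. II.1.1). [folklore] -/
theorem exists_placeValuation_sub_lt_one (P : V.Point) {u : V.FunctionField}
    (hu : placeValuation V P u ≤ 1) :
    ∃ c : k, placeValuation V P (u - algebraMap k V.FunctionField c) < 1 := by
  cases P with
  | zero => exact Literature.NumberTheory.DiophantineGeometry.WeierstrassPlaceAtInfinity.exists_infValuationF_sub_algebraMap_lt_one V hu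
  | some a b h =>
    rw [placeValuation_some] at hu ⊢
    obtain ⟨r, hr⟩ := Literature.NumberTheory.DiophantineGeometry.WeierstrassGenus.exists_valuation_sub_algebraMap_lt_one V _ hu
    refine ⟨pointEval h.left r, ?_⟩
    have hr' : (pointPrime h.left).valuation V.FunctionField
        (algebraMap V.CoordinateRing V.FunctionField r -
          algebraMap k V.FunctionField (pointEval h.left r)) < 1 := by
      rw [IsScalarTower.algebraMap_apply k V.CoordinateRing V.FunctionField, ← map_sub,
        HeightOneSpectrum.valuation_lt_one_iff_mem, pointPrime_asIdeal, mem_pointIdeal_iff h.left,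
        map_sub, pointEval_algebraMap, sub_self]
    have : u - algebraMap k V.FunctionField (pointEval h.left r) =
        (u - algebraMap V.CoordinateRing V.FunctionField r) +
          (algebraMap V.CoordinateRing V.FunctionField r -
            algebraMap k V.FunctionField (pointEval h.left r)) := by ring
    rw [this]
    exact (Valuation.map_add _ _ _).trans_lt (max_lt hr hr')

/-- The constant `c` with `v_P(u - c) < 1` is unique. [folklore] -/
theorem placeValuation_sub_lt_one_unique (P : V.Point) {u : V.FunctionField} {c d : k}
    (hc : placeValuation V P (u - algebraMap k V.FunctionField c) < 1)
    (hd : placeValuation V P (u - algebraMap k V.FunctionField d) < 1) : c = d := by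
  by_contra hcd
  have h1 : placeValuation V P (algebraMap k V.FunctionField (d - c)) = 1 :=
    placeValuation_algebraMap P (sub_ne_zero.mpr (Ne.symm hcd))
  have : algebraMap k V.FunctionField (d - c) =
      (u - algebraMap k V.FunctionField c) - (u - algebraMap k V.FunctionField d) := by
    rw [map_sub]; ring
  rw [this] at h1
  have := (Valuation.map_sub _ _ _).trans_lt (max_lt hc hd)
  rw [h1] at this
  exact lt_irrefl _ this

variable (V) in
/-- **The value `u(P) ∈ k` of `u` at the place `P`** (the residue of `u`; junk value `0` unless
`v_P(u) ≤ 1`). Silverman, *AEC*, II.§1. [folklore] -/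
def placeRes (P : V.Point) (u : V.FunctionField) : k :=
  if h : ∃ c : k, placeValuation V P (u - algebraMap k V.FunctionField c) < 1 then h.choose else 0

/-- Defining property of the residue. [folklore] -/
theorem placeValuation_sub_placeRes_lt_one (P : V.Point) {u : V.FunctionField}
    (hu : placeValuation V P u ≤ 1) :
    placeValuation V P (u - algebraMap k V.FunctionField (placeRes V P u)) < 1 := by
  have h := exists_placeValuation_sub_lt_one P hu
  rw [placeRes, dif_pos h]
  exact h.choose_spec

/-- Characterisation of the residue. [folklore] -/
theorem placeRes_eq_of_lt_one (P : V.Point) {u : V.FunctionField} {c : k}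
    (hc : placeValuation V P (u - algebraMap k V.FunctionField c) < 1) : placeRes V P u = c := by
  have h : ∃ c : k, placeValuation V P (u - algebraMap k V.FunctionField c) < 1 := ⟨c, hc⟩
  rw [placeRes, dif_pos h]
  exact placeValuation_sub_lt_one_unique P h.choose_spec hc

/-- The residue of a constant. [folklore] -/
theorem placeRes_algebraMap (P : V.Point) (c : k) :
    placeRes V P (algebraMap k V.FunctionField c) = c :=
  placeRes_eq_of_lt_one P (by simp)

/-- Residues add. [folklore] -/
theorem placeRes_add (P : V.Point) {u w : V.FunctionField}
    (hu : placeValuation V P u ≤ 1) (hw : placeValuation V P w ≤ 1) :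
    placeRes V P (u + w) = placeRes V P u + placeRes V P w := by
  refine placeRes_eq_of_lt_one P ?_
  have : u + w - algebraMap k V.FunctionField (placeRes V P u + placeRes V P w) =
      (u - algebraMap k _ (placeRes V P u)) + (w - algebraMap k _ (placeRes V P w)) := by
    rw [map_add]; ring
  rw [this]
  exact (Valuation.map_add _ _ _).trans_lt (max_lt (placeValuation_sub_placeRes_lt_one P hu)
    (placeValuation_sub_placeRes_lt_one P hw))

/-- Residues multiply. [folklore] -/
theorem placeRes_mul (P : V.Point) {u w : V.FunctionField}
    (hu : placeValuation V P u ≤ 1) (hw : placeValuation V P w ≤ 1) :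
    placeRes V P (u * w) = placeRes V P u * placeRes V P w := by
  refine placeRes_eq_of_lt_one P ?_
  set c := placeRes V P u
  set d := placeRes V P w
  have : u * w - algebraMap k V.FunctionField (c * d) =
      u * (w - algebraMap k _ d) + algebraMap k _ d * (u - algebraMap k _ c) := by
    rw [map_mul]; ring
  rw [this]
  refine (Valuation.map_add _ _ _).trans_lt (max_lt ?_ ?_)
  · rw [map_mul]
    exact (mul_le_mul_left hu _).trans_lt
      (by rw [one_mul]; exact placeValuation_sub_placeRes_lt_one P hw)
  · rw [map_mul]
    have hd' : placeValuation V P (algebraMap k V.FunctionField d) ≤ 1 := by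
      by_cases hd : d = 0
      · simp [hd]
      · exact (placeValuation_algebraMap P hd).le
    exact (mul_le_mul_left hd' _).trans_lt
      (by rw [one_mul]; exact placeValuation_sub_placeRes_lt_one P hu)

/-- Residues negate. [folklore] -/
theorem placeRes_neg (P : V.Point) {u : V.FunctionField}
    (hu : placeValuation V P u ≤ 1) : placeRes V P (-u) = -placeRes V P u := by
  refine placeRes_eq_of_lt_one P ?_
  rw [map_neg, sub_neg_eq_add, neg_add_eq_sub, ← neg_sub, Valuation.map_neg]
  exact placeValuation_sub_placeRes_lt_one P hu

/-- Residues subtract. [folklore] -/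
theorem placeRes_sub (P : V.Point) {u w : V.FunctionField}
    (hu : placeValuation V P u ≤ 1) (hw : placeValuation V P w ≤ 1) :
    placeRes V P (u - w) = placeRes V P u - placeRes V P w := by
  rw [sub_eq_add_neg, placeRes_add P hu (by rwa [Valuation.map_neg]), placeRes_neg P hw,
    ← sub_eq_add_neg]

/-- A function with non-zero residue is a unit at `P`. [folklore] -/
theorem placeValuation_eq_one_of_placeRes_ne_zero (P : V.Point)
    {u : V.FunctionField} (hu : placeValuation V P u ≤ 1) (h0 : placeRes V P u ≠ 0) :
    placeValuation V P u = 1 := by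
  have h1 := placeValuation_sub_placeRes_lt_one P hu
  have hc : placeValuation V P (algebraMap k V.FunctionField (placeRes V P u)) = 1 :=
    placeValuation_algebraMap P h0
  have : u = (u - algebraMap k _ (placeRes V P u)) + algebraMap k _ (placeRes V P u) := by ring
  rw [this, Valuation.map_add_eq_of_lt_right _ (by rwa [hc]), hc]

/-- Residues invert (for a non-zero residue). [folklore] -/
theorem placeRes_inv (P : V.Point) {u : V.FunctionField}
    (hu : placeValuation V P u ≤ 1) (h0 : placeRes V P u ≠ 0) :
    placeRes V P u⁻¹ = (placeRes V P u)⁻¹ := by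
  have h1 := placeValuation_eq_one_of_placeRes_ne_zero P hu h0
  have hu0 : u ≠ 0 := fun h ↦ by rw [h, map_zero] at h1; exact zero_ne_one h1
  have hinv : placeValuation V P u⁻¹ ≤ 1 := by rw [map_inv₀, h1, inv_one]
  have := placeRes_mul P hu hinv
  rw [mul_inv_cancel₀ hu0, ← (algebraMap k V.FunctionField).map_one, placeRes_algebraMap] at this
  exact (eq_inv_of_mul_eq_one_right this.symm)

/-- At an affine point, the residue of a regular function `w ∈ k[V]` is its value `w(a, b)`.
[folklore] -/
theorem placeRes_some_algebraMap {a b : k} (h : V.Nonsingular a b) (w : V.CoordinateRing) :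
    placeRes V (.some a b h) (algebraMap V.CoordinateRing V.FunctionField w) =
      pointEval h.left w := by
  refine placeRes_eq_of_lt_one _ ?_
  rw [placeValuation_some, IsScalarTower.algebraMap_apply k V.CoordinateRing V.FunctionField,
    ← map_sub, HeightOneSpectrum.valuation_lt_one_iff_mem, pointPrime_asIdeal,
    mem_pointIdeal_iff h.left, map_sub, pointEval_algebraMap, sub_self]

/-- Regular functions are integral at affine points. [folklore] -/
theorem placeValuation_some_algebraMap_le_one {a b : k} (h : V.Nonsingular a b)
    (w : V.CoordinateRing) :
    placeValuation V (.some a b h) (algebraMap V.CoordinateRing V.FunctionField w) ≤ 1 :=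
  HeightOneSpectrum.valuation_le_one _ _

/-- `v_{(a,b)}(w) < 1 ↔ w(a, b) = 0` for `w ∈ k[V]`. [folklore] -/
theorem placeValuation_some_algebraMap_lt_one_iff {a b : k} (h : V.Nonsingular a b)
    (w : V.CoordinateRing) :
    placeValuation V (.some a b h) (algebraMap V.CoordinateRing V.FunctionField w) < 1 ↔
      pointEval h.left w = 0 := by
  rw [placeValuation_some, HeightOneSpectrum.valuation_lt_one_iff_mem, pointPrime_asIdeal,
    mem_pointIdeal_iff h.left]

end Places


/-! ## The degree of a principal divisor is zero

For `w ∈ k[V] ∖ {0}`: `Σ_{P affine} ord_P(w) = dim_k k[V]/(w) = deg N(w) = -ord_O(w)`. -/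

section Degree

variable [V.IsElliptic]

/-- `ord_{(a,b)}(w)` for `w ∈ k[V] ∖ {0}` is the multiplicity of `(x - a, y - b)` in the
factorisation of `(w)`. [folklore] -/
theorem ord_some_algebraMap_eq_count {a b : k} (h : V.Nonsingular a b) {w : V.CoordinateRing}
    (hw : w ≠ 0) : ord V (.some a b h) (algebraMap V.CoordinateRing V.FunctionField w) =
      ((UniqueFactorizationMonoid.normalizedFactors (Ideal.span {w})).count
        (pointIdeal V a b) : ℕ) := by
  rw [ord, placeValuation_some, HeightOneSpectrum.valuation_of_algebraMap,
    HeightOneSpectrum.intValuation_if_neg _ hw, WithZero.log_exp, neg_neg,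
    Ideal.count_associates_factors_eq (by simpa using hw) (pointPrime h.left).isPrime
      (pointPrime h.left).ne_bot]
  rfl

/-- `dim_k k[V]/𝔪^n = n` for the ideal `𝔪` of a point: `𝔪^n/𝔪^{n+1}` is a line, spanned by
the class of any `a ∈ 𝔪^n ∖ 𝔪^{n+1}` (`(a) + 𝔪^{n+1} = 𝔪^n` in the Dedekind domain `k[V]`,
and `k[V]/𝔪 = k`). [folklore] -/
theorem rank_quotient_pointIdeal_pow {a b : k} (h : V.Equation a b) (n : ℕ) :
    Module.rank k (V.CoordinateRing ⧸ pointIdeal V a b ^ n) = n := by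
  set m := pointIdeal V a b with hm
  haveI hmax : m.IsMaximal := pointIdeal_isMaximal h
  have hm0 : m ≠ ⊥ := Literature.NumberTheory.EllipticCurves.WeierstrassCoordinateRing.ne_bot_of_isMaximal (W := V) m
  induction n with
  | zero =>
    rw [pow_zero, Ideal.one_eq_top, Nat.cast_zero]
    haveI : Subsingleton (V.CoordinateRing ⧸ (⊤ : Ideal V.CoordinateRing)) :=
      Ideal.Quotient.subsingleton_iff.mpr rfl
    exact rank_subsingleton' _ _
  | succ n ih =>
    -- the submodule `m^n / m^{n+1}` of `A / m^{n+1}`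
    set N : Submodule k (V.CoordinateRing ⧸ m ^ (n + 1)) :=
      ((m ^ n).map (Ideal.Quotient.mkₐ k (m ^ (n + 1)))).restrictScalars k with hN
    -- the quotient by it is `A / m^n`
    have hquot : Module.rank k ((V.CoordinateRing ⧸ m ^ (n + 1)) ⧸ N) = n := by
      rw [← ih, hN, (Submodule.Quotient.restrictScalarsEquiv k _).rank_eq]
      exact (DoubleQuot.quotQuotEquivQuotOfLEₐ k
        (Ideal.pow_le_pow_right (Nat.le_succ n))).toLinearEquiv.rank_eq
    -- an element `a₀ ∈ m^n ∖ m^{n+1}`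
    obtain ⟨a₀, ha₀, ha₀'⟩ := SetLike.exists_of_lt
      (Ideal.pow_right_strictAnti m hm0 hmax.ne_top (Nat.lt_succ_self n))
    have hsup : Ideal.span {a₀} ⊔ m ^ (n + 1) = m ^ n := by
      have hspan0 : Ideal.span {a₀} ≠ ⊥ := fun h0 ↦ ha₀' (by
        rw [Ideal.span_singleton_eq_bot.mp h0]; exact Ideal.zero_mem _)
      have hle : Ideal.span {a₀} ≤ m ^ n := (Ideal.span_singleton_le_iff_mem _).mpr ha₀
      have hlt : ¬ Ideal.span {a₀} ≤ m ^ (n + 1) := fun h' ↦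
        ha₀' ((Ideal.span_singleton_le_iff_mem _).mp h')
      rw [sup_comm,
        Ideal.irreducible_pow_sup hspan0 (Ideal.prime_of_isPrime hm0 hmax.isPrime).irreducible,
        Ideal.count_normalizedFactors_eq hle hlt, min_eq_left (Nat.le_succ n)]
    -- `N` is the line spanned by the class of `a₀`
    have hspan : N = k ∙ (Ideal.Quotient.mk (m ^ (n + 1)) a₀) := by
      refine le_antisymm ?_ ?_
      · intro x hx
        rw [hN, Submodule.restrictScalars_mem,
          Ideal.mem_map_iff_of_surjective _ (Ideal.Quotient.mkₐ_surjective k _)] at hx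
        obtain ⟨y, hy, rfl⟩ := hx
        rw [Ideal.Quotient.mkₐ_eq_mk]
        rw [← hsup] at hy
        obtain ⟨ra, hra, z, hz, rfl⟩ := Submodule.mem_sup.mp hy
        obtain ⟨r, rfl⟩ := Ideal.mem_span_singleton'.mp hra
        set c := pointEval h r with hc
        have hrc : r - algebraMap k V.CoordinateRing c ∈ m := by
          rw [hm, mem_pointIdeal_iff h, map_sub, pointEval_algebraMap, sub_self]
        rw [Submodule.mem_span_singleton]
        refine ⟨c, ?_⟩
        rw [eq_comm, ← sub_eq_zero, Algebra.smul_def, ← Ideal.Quotient.mk_algebraMap, ← map_mul,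
          ← map_sub, Ideal.Quotient.eq_zero_iff_mem,
          show r * a₀ + z - algebraMap k V.CoordinateRing c * a₀ =
            (r - algebraMap k V.CoordinateRing c) * a₀ + z by ring]
        refine Ideal.add_mem _ ?_ hz
        rw [pow_succ']
        exact Ideal.mul_mem_mul hrc ha₀
      · rw [Submodule.span_singleton_le_iff_mem, hN, Submodule.restrictScalars_mem]
        exact Ideal.mem_map_of_mem (Ideal.Quotient.mkₐ k (m ^ (n + 1))) ha₀
    have hne : Ideal.Quotient.mk (m ^ (n + 1)) a₀ ≠ 0 := fun h0 ↦
      ha₀' (Ideal.Quotient.eq_zero_iff_mem.mp h0)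
    have hrankN : Module.rank k N = 1 := by
      rw [hspan, ← (LinearEquiv.toSpanNonzeroSingleton k _ _ hne).rank_eq, Module.rank_self]
    have := Submodule.rank_quotient_add_rank N
    rw [hquot, hrankN] at this
    rw [← this, Nat.cast_succ]

/-- `dim_k k[V]/𝔪^n = n` (natural number version). [folklore] -/
theorem finrank_quotient_pointIdeal_pow {a b : k} (h : V.Equation a b) (n : ℕ) :
    Module.finrank k (V.CoordinateRing ⧸ pointIdeal V a b ^ n) = n :=
  Module.finrank_eq_of_rank_eq (rank_quotient_pointIdeal_pow h n)

/-- A `k`-linear version of Mathlib's Chinese remainder equivalence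
`k[V]/I ≅ Π k[V]/𝔪^{e_𝔪}` (`IsDedekindDomain.quotientEquivPiFactors`). [folklore] -/
def quotientEquivPiFactorsLinear {I : Ideal V.CoordinateRing} (hI : I ≠ ⊥) :
    (V.CoordinateRing ⧸ I) ≃ₗ[k] ∀ P : (UniqueFactorizationMonoid.factors I).toFinset,
      V.CoordinateRing ⧸ (P : Ideal V.CoordinateRing) ^
        ((UniqueFactorizationMonoid.factors I).count ↑P) :=
  { IsDedekindDomain.quotientEquivPiFactors hI with
    map_smul' := fun c x ↦ by
      obtain ⟨y, rfl⟩ := Ideal.Quotient.mk_surjective x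
      change IsDedekindDomain.quotientEquivPiFactors hI (c • Ideal.Quotient.mk I y) =
        c • IsDedekindDomain.quotientEquivPiFactors hI (Ideal.Quotient.mk I y)
      rw [show c • Ideal.Quotient.mk I y = Ideal.Quotient.mk I (c • y) from rfl,
        IsDedekindDomain.quotientEquivPiFactors_mk, IsDedekindDomain.quotientEquivPiFactors_mk]
      rfl }

/-- **`dim_k k[V]/(w) = Σ_𝔪 e_𝔪`** for `(w) = Π 𝔪^{e_𝔪}` (`k` algebraically closed, so that
every maximal ideal is the ideal of a point and `dim k[V]/𝔪^e = e`). [folklore] -/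
theorem finrank_quotient_span_eq_sum_count [IsAlgClosed k] {w : V.CoordinateRing} (hw : w ≠ 0) :
    Module.finrank k (V.CoordinateRing ⧸ Ideal.span {w}) =
      ∑ P ∈ (UniqueFactorizationMonoid.factors (Ideal.span {w})).toFinset,
        (UniqueFactorizationMonoid.factors (Ideal.span {w})).count P := by
  have hI : Ideal.span {w} ≠ ⊥ := by simpa using hw
  have hfac : ∀ P ∈ (UniqueFactorizationMonoid.factors (Ideal.span {w})).toFinset, ∀ e : ℕ,
      Module.finrank k (V.CoordinateRing ⧸ P ^ e) = e := by
    intro P hP e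
    have hprime := UniqueFactorizationMonoid.prime_of_factor P (Multiset.mem_toFinset.mp hP)
    haveI : P.IsPrime := Ideal.isPrime_of_prime hprime
    haveI : P.IsMaximal := Ideal.IsPrime.isMaximal inferInstance hprime.ne_zero
    obtain ⟨a, b, hab, rfl⟩ := exists_eq_pointIdeal (V := V) P
    exact finrank_quotient_pointIdeal_pow hab e
  haveI : ∀ P : (UniqueFactorizationMonoid.factors (Ideal.span {w})).toFinset,
      Module.Finite k (V.CoordinateRing ⧸ (P : Ideal V.CoordinateRing) ^
        ((UniqueFactorizationMonoid.factors (Ideal.span {w})).count ↑P)) := by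
    intro P
    by_cases h0 : (UniqueFactorizationMonoid.factors (Ideal.span {w})).count ↑P = 0
    · rw [h0, pow_zero, Ideal.one_eq_top]
      haveI : Subsingleton (V.CoordinateRing ⧸ (⊤ : Ideal V.CoordinateRing)) :=
        Ideal.Quotient.subsingleton_iff.mpr rfl
      infer_instance
    · exact Module.finite_of_finrank_pos (by rw [hfac P P.2]; exact Nat.pos_of_ne_zero h0)
  rw [(quotientEquivPiFactorsLinear hI).finrank_eq, Module.finrank_pi_fintype, Finset.sum_coe_sort
    (UniqueFactorizationMonoid.factors (Ideal.span {w})).toFinset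
    (fun P ↦ Module.finrank k (V.CoordinateRing ⧸ P ^
      (UniqueFactorizationMonoid.factors (Ideal.span {w})).count P))]
  exact Finset.sum_congr rfl fun P hP ↦ hfac P hP _

/-- **`dim_k k[V]/(w) = deg N(w)`** (Mathlib's `finrank_quotient_span_eq_natDegree_norm`), i.e.
the number of affine zeros of `w` counted with multiplicity is the order of its pole at `O`.
Silverman, *AEC*, II.§1, Prop. II.1.2 / II.3.1 (`deg div(f) = 0`). [folklore] -/
theorem sum_count_eq_normDeg [IsAlgClosed k] {w : V.CoordinateRing} (hw : w ≠ 0) :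
    ∑ P ∈ (UniqueFactorizationMonoid.factors (Ideal.span {w})).toFinset,
        (UniqueFactorizationMonoid.factors (Ideal.span {w})).count P = normDeg V w := by
  rw [← finrank_quotient_span_eq_sum_count hw, normDeg,
    finrank_quotient_span_eq_natDegree_norm (WeierstrassCurve.Affine.CoordinateRing.basis V) hw]

/-- The point of a maximal ideal (`k` algebraically closed; junk value `O` on other ideals).
[folklore] -/
def pointOfIdeal (I : Ideal V.CoordinateRing) : V.Point :=
  if h : ∃ a b : k, ∃ _ : V.Equation a b, I = pointIdeal V a b then
    .some h.choose h.choose_spec.choose ((WeierstrassCurve.Affine.equation_iff_nonsingular).mp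
      h.choose_spec.choose_spec.choose)
  else 0

/-- The point of the ideal of a point. [folklore] -/
theorem pointOfIdeal_pointIdeal {a b : k} (h : V.Nonsingular a b) :
    pointOfIdeal (pointIdeal V a b) = .some a b h := by
  have hex : ∃ a' b' : k, ∃ _ : V.Equation a' b', pointIdeal V a b = pointIdeal V a' b' :=
    ⟨a, b, h.left, rfl⟩
  rw [pointOfIdeal, dif_pos hex]
  obtain ⟨ha, hb⟩ := pointIdeal_injective h.left hex.choose_spec.choose_spec.choose_spec
  simp only [WeierstrassCurve.Affine.Point.some.injEq]
  exact ⟨ha.symm, hb.symm⟩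

/-- `ord_O(w) = -deg N(w)` for `w ∈ k[V] ∖ {0}`. [folklore] -/
theorem ord_zero_algebraMap {w : V.CoordinateRing} (hw : w ≠ 0) :
    ord V 0 (algebraMap V.CoordinateRing V.FunctionField w) = -(normDeg V w : ℤ) := by
  rw [ord, placeValuation_zero, infValuationF_algebraMap_of_ne_zero hw, WithZero.log_exp]

/-- The support of `P ↦ ord_P(w)` (`w ∈ k[V] ∖ {0}`) is contained in `O` and the points of the
prime factors of `(w)`. [folklore] -/
theorem support_ord_algebraMap_subset [IsAlgClosed k] {w : V.CoordinateRing} (hw : w ≠ 0) :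
    (Function.support fun P ↦ ord V P (algebraMap V.CoordinateRing V.FunctionField w)) ⊆
      insert 0 ((UniqueFactorizationMonoid.factors (Ideal.span {w})).toFinset.image
        pointOfIdeal) := by
  intro P hP
  rw [Function.mem_support] at hP
  cases P with
  | zero => exact Set.mem_insert _ _
  | some a b h =>
    refine Set.mem_insert_of_mem _ ?_
    rw [Finset.coe_image, Set.mem_image]
    refine ⟨pointIdeal V a b, ?_, pointOfIdeal_pointIdeal h⟩
    rw [Finset.mem_coe, Multiset.mem_toFinset,
      UniqueFactorizationMonoid.factors_eq_normalizedFactors, ← Multiset.count_ne_zero]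
    rw [ord_some_algebraMap_eq_count h hw] at hP
    exact_mod_cast hP

/-- The support of `P ↦ ord_P(u)` is finite for `u ≠ 0`: **a rational function has finitely many
zeros and poles.** [cite: SilvermanAEC2009, Prop. II.1.2] -/
theorem finite_support_ord [IsAlgClosed k] {u : V.FunctionField} (hu : u ≠ 0) :
    (Function.support fun P ↦ ord V P u).Finite := by
  obtain ⟨w₁, w₂, hw₂, rfl⟩ := IsFractionRing.div_surjective (A := V.CoordinateRing) u
  have hw₂' : (w₂ : V.CoordinateRing) ≠ 0 := nonZeroDivisors.ne_zero hw₂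
  have hw₁ : w₁ ≠ 0 := by
    rintro rfl
    simp at hu
  have h1 := (Set.finite_insert.mpr (Finset.finite_toSet _)).subset
    (support_ord_algebraMap_subset (V := V) hw₁)
  have h2 := (Set.finite_insert.mpr (Finset.finite_toSet _)).subset
    (support_ord_algebraMap_subset (V := V) hw₂')
  refine (h1.union h2).subset fun P hP ↦ ?_
  rw [Function.mem_support, ord_div P (by simpa using hw₁) (by simpa using hw₂')] at hP
  by_contra hP'
  simp only [Set.mem_union, Function.mem_support, not_or, not_not] at hP'
  rw [hP'.1, hP'.2, sub_zero] at hP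
  exact hP rfl

/-- **The degree of the divisor of `w ∈ k[V] ∖ {0}` is zero**: `Σ_P ord_P(w) = 0`, the sum over
all points of `V` including `O` (the affine zeros counted with multiplicity number `deg N(w)`,
the order of the pole at `O`). [cite: SilvermanAEC2009, Prop. II.3.1(b)] -/
theorem finsum_ord_algebraMap [IsAlgClosed k] {w : V.CoordinateRing} (hw : w ≠ 0) :
    ∑ᶠ P : V.Point, ord V P (algebraMap V.CoordinateRing V.FunctionField w) = 0 := by
  set T := (UniqueFactorizationMonoid.factors (Ideal.span {w})).toFinset with hT
  have h0 : (0 : V.Point) ∉ T.image pointOfIdeal := by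
    rw [Finset.mem_image]
    rintro ⟨I, hI, hI0⟩
    have hprime := UniqueFactorizationMonoid.prime_of_factor I (Multiset.mem_toFinset.mp hI)
    haveI : I.IsPrime := Ideal.isPrime_of_prime hprime
    haveI : I.IsMaximal := Ideal.IsPrime.isMaximal inferInstance hprime.ne_zero
    obtain ⟨a, b, hab, rfl⟩ := exists_eq_pointIdeal (V := V) I
    rw [pointOfIdeal_pointIdeal ((WeierstrassCurve.Affine.equation_iff_nonsingular).mp hab)] at hI0
    exact WeierstrassCurve.Affine.Point.some_ne_zero _ hI0
  have hinj : Set.InjOn pointOfIdeal (T : Set (Ideal V.CoordinateRing)) := by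
    intro I hI J hJ hIJ
    have hpI := UniqueFactorizationMonoid.prime_of_factor I (Multiset.mem_toFinset.mp hI)
    have hpJ := UniqueFactorizationMonoid.prime_of_factor J (Multiset.mem_toFinset.mp hJ)
    haveI : I.IsPrime := Ideal.isPrime_of_prime hpI
    haveI : I.IsMaximal := Ideal.IsPrime.isMaximal inferInstance hpI.ne_zero
    haveI : J.IsPrime := Ideal.isPrime_of_prime hpJ
    haveI : J.IsMaximal := Ideal.IsPrime.isMaximal inferInstance hpJ.ne_zero
    obtain ⟨a, b, hab, rfl⟩ := exists_eq_pointIdeal (V := V) I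
    obtain ⟨a', b', hab', rfl⟩ := exists_eq_pointIdeal (V := V) J
    rw [pointOfIdeal_pointIdeal ((WeierstrassCurve.Affine.equation_iff_nonsingular).mp hab),
      pointOfIdeal_pointIdeal ((WeierstrassCurve.Affine.equation_iff_nonsingular).mp hab')] at hIJ
    obtain ⟨rfl, rfl⟩ := WeierstrassCurve.Affine.Point.some.inj hIJ
    rfl
  have hsub : (Function.support fun P ↦ ord V P (algebraMap V.CoordinateRing V.FunctionField w)) ⊆
      ((insert 0 (T.image pointOfIdeal) : Finset V.Point) : Set V.Point) := by
    rw [Finset.coe_insert]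
    exact support_ord_algebraMap_subset (V := V) hw
  rw [finsum_eq_sum_of_support_subset _ hsub, Finset.sum_insert h0, Finset.sum_image hinj,
    ord_zero_algebraMap hw]
  have : ∑ I ∈ T, ord V (pointOfIdeal I) (algebraMap V.CoordinateRing V.FunctionField w) =
      ∑ I ∈ T, ((UniqueFactorizationMonoid.factors (Ideal.span {w})).count I : ℤ) := by
    refine Finset.sum_congr rfl fun I hI ↦ ?_
    have hpI := UniqueFactorizationMonoid.prime_of_factor I (Multiset.mem_toFinset.mp hI)
    haveI : I.IsPrime := Ideal.isPrime_of_prime hpI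
    haveI : I.IsMaximal := Ideal.IsPrime.isMaximal inferInstance hpI.ne_zero
    obtain ⟨a, b, hab, rfl⟩ := exists_eq_pointIdeal (V := V) I
    rw [pointOfIdeal_pointIdeal ((WeierstrassCurve.Affine.equation_iff_nonsingular).mp hab),
      ord_some_algebraMap_eq_count _ hw, UniqueFactorizationMonoid.factors_eq_normalizedFactors]
  rw [this, ← Nat.cast_sum, sum_count_eq_normDeg hw, neg_add_cancel]

/-- **The degree of a principal divisor is zero**: `Σ_P ord_P(u) = 0` for every
`u ∈ k(V) ∖ {0}` — the specialisation to `k` algebraically closed (all places of `k(V)/k` are the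
points of `V(k) ∪ {O}`, of degree one) of the tree's
`Literature.NumberTheory.DiophantineGeometry.AlgFunctionField.degree_principalDivisor_eq_zero` (Stichtenoth Thm. 1.4.11), proved here
directly for the point-indexed `ord` by the count `dim_k k[V]/(w) = deg N(w)`.
[cite: SilvermanAEC2009, Prop. II.3.1(b)] -/
theorem finsum_ord [IsAlgClosed k] {u : V.FunctionField} (hu : u ≠ 0) :
    ∑ᶠ P : V.Point, ord V P u = 0 := by
  obtain ⟨w₁, w₂, hw₂, rfl⟩ := IsFractionRing.div_surjective (A := V.CoordinateRing) u
  have hw₂' : (w₂ : V.CoordinateRing) ≠ 0 := nonZeroDivisors.ne_zero hw₂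
  have hw₁ : w₁ ≠ 0 := by
    rintro rfl
    simp at hu
  have hf : ∀ P : V.Point, ord V P (algebraMap _ V.FunctionField w₁ / algebraMap _ _ ↑w₂) =
      ord V P (algebraMap _ V.FunctionField w₁) - ord V P (algebraMap _ _ ↑w₂) := fun P ↦
    ord_div P (by simpa using hw₁) (by simpa using hw₂')
  simp_rw [hf]
  rw [finsum_sub_distrib (finite_support_ord (by simpa using hw₁))
    (finite_support_ord (by simpa using hw₂')), finsum_ord_algebraMap hw₁,
    finsum_ord_algebraMap hw₂', sub_zero]

end Degree

end Literature.NumberTheory.EllipticCurves.WeierstrassFunctionField
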